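import Literature.AlgebraicGeometry.Kawanoue2007.LeadingGeneratorSystem
import HarnessLib

/-!
# Kawanoue 2007, Part I, Def. 3.2.2.1: the order `ord_ℋ` modulo a leading generator system and the invariant `μ̃`

H. Kawanoue, *Toward resolution of singularities over a field of positive characteristic. Part I. Foundation;
the language of the idealistic filtration*, Publ. RIMS **43** (2007) 819–909 (= arXiv:math/0607009)
[Kawanoue2007]; §3.2.2 «Invariant `μ̃`», read on the held arXiv text (`lit read paper:arxiv-math-0607009`,
chunk p0084 L11–L25 = Def. 3.2.2.1, p0084 L27–p0085 L5 = Remark 3.2.2.2 (1)–(5); re-read before typing).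
Sequel of `LeadingGeneratorSystem.lean` (Def. 2.1.1.1 (5) `μ_P`, Def. 3.1.3.1 `IsLGS`, Def. 3.2.1.1 `σ`), which
left §3.2.2 «deliberately NOT here». Campaign `res-hironaka` (D-0089), rung LIT-6 (Kawanoue / Kawanoue–Matsuki,
the Idealistic Filtration Program as a refereed comparison programme); typed now because the director's
critic-side batch ORDER (2026-08-27T14:38:23Z, paper (6)) asks for «the IFP invariant as a CANDIDATE FAMILY
(F10 «IFP-type», each component typed)» — `σ` is `LeadingGeneratorSystem.sigma`, this file is `μ̃`. VOCABULARY
file: REAL definitions with elementary API PROVED; NO named facts (Part II's theorems — independence of the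
leading generator system, Prop. 3.1.2.1; upper semicontinuity of `(σ, μ̃)`, Prop. 3.3.1.1 — are neither
asserted nor assumed); nothing of Hironaka's 2017 manuscript is referred to or asserted.

## What is typed, and how (faithfulness notes)

* **Def. 3.2.2.1, `ord_ℋ`** (p0084 L13–L23): «Let `𝕀` be a 𝔇-saturated idealistic filtration. Take a leading
  generator system `ℍ = {(h_{ij}, p^{e_i})}` of `𝕀`. Set `ℋ = {h_{ij}}` and `(ℋ) ⊂ R` to be the ideal generated by
  `ℋ`. For `f ∈ R`, define its multiplicity (or order) modulo `(ℋ)` to be `ord_ℋ(f) = sup{n ∈ ℤ_{>0} ; f ∈ 𝔪ⁿ +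
  (ℋ)}` … (Note that we set `ord_ℋ(0) = ∞` by definition.)» Typed for ANY ideal `I` of a local ring `(R, 𝔪)` as
  `ordMod I f := sup {n ; f ∈ 𝔪ⁿ ⊔ I} ∈ ℕ∞` (so `ordMod (ℋ) = ord_ℋ`; `ord_ℋ(0) = ∞` and indeed `ord_ℋ(h) = ∞` for
  every `h ∈ (ℋ)` hold by the formula, `ordMod_eq_top_of_mem`; the printed `sup` over `ℤ_{>0}` and ours over
  `ℤ_{≥0}` agree since `f ∈ 𝔪⁰ + (ℋ) = R` always). It is the `𝔪/(ℋ)`-adic order of `f mod (ℋ)` in `R/(ℋ)`;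
  `ordMod ⊥ = ` the tree's `Resolution.adicOrder` (`ordMod_bot`). PROVED: `le_ordMod_iff` (`n ≤ ord_ℋ(f) ⟺ f ∈
  𝔪ⁿ + (ℋ)`), `adicOrder_le_ordMod`, `ordMod_mono`, `ordMod_one_of_ne_top`.
* **Def. 3.2.2.1, `μ_ℋ` and `μ̃`** (p0084 L19–L25): «`μ_ℋ(𝕀) := inf { μ_ℋ(f, a) := ord_ℋ(f)/a ; (f, a) ∈ 𝕀, a > 0 }`
  … We define the invariant `μ̃` by `μ̃ = μ_ℋ(𝕀)`.» Typed exactly as `LeadingGeneratorSystem.mu` was (values in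
  `[0, ∞]`, `inf ∅ = ∞`): `muModElem I f a = ord_ℋ(f)/a`, `muMod I T` for `T ⊂ R × ℝ`, and **`muTilde 𝕀 h :=
  μ_{(ℋ)}(𝕀)` for a FAMILY `h : ι → R`** (the `h_{ij}` of a leading generator system, flattened to one index as in
  `IsLGS`) with `(ℋ) = Ideal.span (range h)`. The definition is stated for any family `h`; it is Kawanoue's `μ̃`
  when `(h, e)` is a leading generator system of the 𝔇-saturated `𝕀` (`IsLGS p 𝕀 h e`) — Remark 3.2.2.2 (1)
  p0085 L1: «We will see in Part II that `μ_ℋ(𝕀)` is independent of the choice of a leading generator system» is a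
  THEOREM of Part II (Prop. 3.1.2.1 there), NOT proved or assumed here, so consumers carry the family. PROVED:
  `muTilde_le` / `le_muTilde_iff` (unfolding), `muTilde_anti` (bigger filtration, smaller `μ̃`), `muMod_mono` (bigger
  ideal, bigger `μ`), `muTilde_of_isEmpty` (no leading generators, `σ(e) = d` for all `e`: `μ̃ = μ_{⊥}` = the plain
  order infimum through `ordMod_bot`), `muTilde_eq_top_of_mem` (`μ̃ = ∞` when every member lies in `(ℋ)`).
* Remark 3.2.2.2 (3) p0085 L3 «in our algorithm, the invariant `μ̃` is actually computed as `μ_{ℋ,E}(𝕀)`, using …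
  the boundary divisor `E`» and (5) p0085 L5 «in characteristic zero, `μ̃` corresponds to the multiplicity of … the
  coefficient ideal (restricted to a hypersurface of maximal contact)» are recorded, not typed (no boundary here).
  Polynomial-model versions of `σ`, `μ̃` for explicit hypersurfaces live in `Resolution/PointBlowupIFPUnit.lean`
  (a different, coordinate carrier); this file is the abstract Def. 3.2.2.1 on `IdealisticFiltration`.

## References

* H. Kawanoue, Publ. RIMS 43 (2007) 819–909 = arXiv:math/0607009: Def. 3.2.2.1, Rem. 3.2.2.2. [Kawanoue2007]
* H. Kawanoue, K. Matsuki, Publ. RIMS 46 (2010) 359–422 = arXiv:math/0612008 (Part II): Prop. 3.1.2.1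
  (independence), Prop. 3.3.1.1 (u.s.c. of `(σ, μ̃)`) — cited for scope, not used. [KawanoueMatsuki2010]
-/

noncomputable section

namespace Literature.AlgebraicGeometry.Kawanoue2007

open Literature.AlgebraicGeometry.Resolution (adicOrder le_adicOrder_iff)
open IsLocalRing
open scoped ENNReal

/-! ## Def. 3.2.2.1: `ord_ℋ(f) = sup {n ; f ∈ 𝔪ⁿ + (ℋ)}` -/

section OrdMod

variable {R : Type*} [CommRing R] [IsLocalRing R]

/-- **`ord_ℋ(f)`, the order of `f` modulo the ideal `I = (ℋ)`** [Kawanoue 2007, Def. 3.2.2.1 p0084 L15–L23 «define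
its multiplicity (or order) modulo `(ℋ)` to be `ord_ℋ(f) = sup{n ∈ ℤ_{>0} ; f ∈ 𝔪ⁿ + (ℋ)}` … we set `ord_ℋ(0) = ∞`»]:
`sup {n ; f ∈ 𝔪ⁿ ⊔ I} ∈ ℕ∞` in a local ring `(R, 𝔪)`, for any ideal `I` (Kawanoue: `I` = the ideal generated by the
elements of a leading generator system). [cite: Kawanoue2007, Def. 3.2.2.1] -/
def ordMod (I : Ideal R) (f : R) : ℕ∞ :=
  ⨆ n : {n : ℕ // f ∈ maximalIdeal R ^ n ⊔ I}, (n.1 : ℕ∞)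

/-- `n ≤ ord_ℋ(f) ⟺ f ∈ 𝔪ⁿ + (ℋ)` (the defining `sup` is attained on an initial segment). [cite: Kawanoue2007, Def. 3.2.2.1] -/
theorem le_ordMod_iff (I : Ideal R) (f : R) (n : ℕ) :
    (n : ℕ∞) ≤ ordMod I f ↔ f ∈ maximalIdeal R ^ n ⊔ I := by
  constructor
  · intro h
    by_contra hn
    have hlt : ∀ i : {i : ℕ // f ∈ maximalIdeal R ^ i ⊔ I}, i.1 < n := by
      intro i
      by_contra hi
      exact hn (sup_le_sup_right (Ideal.pow_le_pow_right (not_lt.mp hi)) I i.2)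
    have hn0 : n ≠ 0 := by
      rintro rfl
      exact hn (by rw [pow_zero, Ideal.one_eq_top, top_sup_eq]; exact Submodule.mem_top)
    have : ordMod I f ≤ ((n - 1 : ℕ) : ℕ∞) :=
      iSup_le fun i => by exact_mod_cast Nat.le_sub_one_of_lt (hlt i)
    have h' : n ≤ n - 1 := by exact_mod_cast h.trans this
    omega
  · intro h
    exact le_iSup (fun i : {i : ℕ // f ∈ maximalIdeal R ^ i ⊔ I} => (i.1 : ℕ∞)) ⟨n, h⟩

/-- `ord_ℋ(h) = ∞` for `h ∈ (ℋ)` (in particular the printed convention «`ord_ℋ(0) = ∞`»). [cite: Kawanoue2007, Def. 3.2.2.1] -/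
theorem ordMod_eq_top_of_mem {I : Ideal R} {f : R} (hf : f ∈ I) : ordMod I f = ⊤ :=
  ENat.eq_top_iff_forall_ge.mpr fun n => (le_ordMod_iff I f n).mpr (Ideal.mem_sup_right hf)

/-- «we set `ord_ℋ(0) = ∞` by definition» (p0084 L23) — here a consequence of the formula. [cite: Kawanoue2007, Def. 3.2.2.1] -/
@[simp] theorem ordMod_zero (I : Ideal R) : ordMod I (0 : R) = ⊤ :=
  ordMod_eq_top_of_mem I.zero_mem

/-- `ord_𝔪(f) ≤ ord_ℋ(f)`: the order modulo `(ℋ)` is at least the plain `𝔪`-adic order (`𝔪ⁿ ⊆ 𝔪ⁿ + (ℋ)`).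
[cite: Kawanoue2007, Def. 3.2.2.1] -/
theorem adicOrder_le_ordMod (I : Ideal R) (f : R) : adicOrder f ≤ ordMod I f :=
  ENat.forall_natCast_le_iff_le.mp fun n hn =>
    (le_ordMod_iff I f n).mpr (Ideal.mem_sup_left ((le_adicOrder_iff f n).mp hn))

/-- A bigger ideal gives a bigger order modulo it. [cite: Kawanoue2007, Def. 3.2.2.1] -/
theorem ordMod_mono {I J : Ideal R} (hIJ : I ≤ J) (f : R) : ordMod I f ≤ ordMod J f :=
  ENat.forall_natCast_le_iff_le.mp fun n hn =>
    (le_ordMod_iff J f n).mpr (sup_le_sup_left hIJ _ ((le_ordMod_iff I f n).mp hn))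

/-- With no leading generators (`(ℋ) = 0`), `ord_ℋ` is the `𝔪`-adic order `Resolution.adicOrder`.
[cite: Kawanoue2007, Def. 3.2.2.1] -/
theorem ordMod_bot (f : R) : ordMod (⊥ : Ideal R) f = adicOrder f := by
  refine le_antisymm ?_ (adicOrder_le_ordMod ⊥ f)
  refine ENat.forall_natCast_le_iff_le.mp fun n hn => ?_
  rw [le_ordMod_iff, sup_bot_eq] at hn
  exact (le_adicOrder_iff f n).mpr hn

/-- `ord_ℋ(1) = 0` when `(ℋ)` is a proper ideal (`1 ∉ 𝔪 + (ℋ) = 𝔪`). [cite: Kawanoue2007, Def. 3.2.2.1] -/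
theorem ordMod_one_of_ne_top {I : Ideal R} (hI : I ≠ ⊤) : ordMod I (1 : R) = 0 := by
  refine le_antisymm ?_ bot_le
  by_contra h
  have h1 : ((1 : ℕ) : ℕ∞) ≤ ordMod I 1 := by
    rw [Nat.cast_one]
    exact Order.one_le_iff_ne_zero.mpr fun h0 => h (le_of_eq h0)
  rw [le_ordMod_iff, pow_one] at h1
  have hle : maximalIdeal R ⊔ I ≤ maximalIdeal R := sup_le le_rfl (IsLocalRing.le_maximalIdeal hI)
  exact (IsLocalRing.maximalIdeal.isMaximal R).ne_top (Ideal.eq_top_of_isUnit_mem _ (hle h1) isUnit_one)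

end OrdMod

section MuMod

variable {R : Type*} [CommRing R] [IsLocalRing R]

/-! ## Def. 3.2.2.1: `μ_ℋ(𝕀)` and the invariant `μ̃` -/

/-- `μ_ℋ(f, a) := ord_ℋ(f)/a` [Kawanoue 2007, Def. 3.2.2.1 p0084 L19–L21]; value in `[0, ∞]`, used for `a > 0` only
(for `a ≤ 0` a junk value, as in `LeadingGeneratorSystem.muElem`). [cite: Kawanoue2007, Def. 3.2.2.1] -/
def muModElem (I : Ideal R) (f : R) (a : ℝ) : ℝ≥0∞ :=
  ((ordMod I f : ℕ∞) : ℝ≥0∞) / ENNReal.ofReal a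

/-- **`μ_ℋ(T) := inf { ord_ℋ(f)/a ; (f, a) ∈ T, a > 0 }`** for `T ⊂ R × ℝ` and an ideal `I = (ℋ)` [Kawanoue 2007,
Def. 3.2.2.1 p0084 L19–L21] (`inf ∅ = ∞`; same shape as `LeadingGeneratorSystem.mu` with `ord_P` replaced by `ord_ℋ`).
[cite: Kawanoue2007, Def. 3.2.2.1] -/
def muMod (I : Ideal R) (T : Set (R × ℝ)) : ℝ≥0∞ :=
  ⨅ x ∈ {x : R × ℝ | x ∈ T ∧ 0 < x.2}, muModElem I x.1 x.2

/-- `μ_ℋ(T) ≤ ord_ℋ(f)/a` for every member `(f, a)`, `a > 0`. [cite: Kawanoue2007, Def. 3.2.2.1] -/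
theorem muMod_le_muModElem (I : Ideal R) {T : Set (R × ℝ)} {f : R} {a : ℝ}
    (h : (f, a) ∈ T) (ha : 0 < a) : muMod I T ≤ muModElem I f a :=
  iInf₂_le (f, a) ⟨h, ha⟩

/-- `c ≤ μ_ℋ(T) ⟺ c ≤ ord_ℋ(f)/a` for all members with `a > 0`. [cite: Kawanoue2007, Def. 3.2.2.1] -/
theorem le_muMod_iff (I : Ideal R) {T : Set (R × ℝ)} {c : ℝ≥0∞} :
    c ≤ muMod I T ↔ ∀ (f : R) (a : ℝ), (f, a) ∈ T → 0 < a → c ≤ muModElem I f a := by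
  simp only [muMod, le_iInf_iff, Set.mem_setOf_eq, and_imp, Prod.forall]

/-- Monotonicity of `μ_ℋ(f, a)` in the ideal. [cite: Kawanoue2007, Def. 3.2.2.1] -/
theorem muModElem_mono {I J : Ideal R} (hIJ : I ≤ J) (f : R) (a : ℝ) : muModElem I f a ≤ muModElem J f a := by
  unfold muModElem
  gcongr
  exact ordMod_mono hIJ f

/-- A bigger ideal `(ℋ) ⊆ (ℋ')` gives a bigger `μ`: `μ_ℋ(T) ≤ μ_{ℋ'}(T)`. [cite: Kawanoue2007, Def. 3.2.2.1] -/
theorem muMod_mono {I J : Ideal R} (hIJ : I ≤ J) (T : Set (R × ℝ)) : muMod I T ≤ muMod J T :=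
  (le_muMod_iff J).mpr fun f a h ha => (muMod_le_muModElem I h ha).trans (muModElem_mono hIJ f a)

/-- A bigger set has a smaller infimum: `T ⊆ T' ⇒ μ_ℋ(T') ≤ μ_ℋ(T)`. [cite: Kawanoue2007, Def. 3.2.2.1] -/
theorem muMod_anti (I : Ideal R) {T T' : Set (R × ℝ)} (hT : T ⊆ T') : muMod I T' ≤ muMod I T :=
  (le_muMod_iff I).mpr fun _ _ h ha => muMod_le_muModElem I (hT h) ha

end MuMod

section MuTilde

variable {R : Type*} [CommRing R] [IsLocalRing R]

/-- **The invariant `μ̃ = μ_ℋ(𝕀)`** [Kawanoue 2007, Def. 3.2.2.1 p0084 L13–L25 «Take a leading generator system `ℍ =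
{(h_{ij}, p^{e_i})}` of `𝕀`. Set `ℋ = {h_{ij}}` and `(ℋ) ⊂ R` to be the ideal generated by `ℋ` … We define the invariant
`μ̃` by `μ̃ = μ_ℋ(𝕀)`»]: for an idealistic filtration `𝕀` and a family `h : ι → R` (the elements `h_{ij}` of a leading
generator system, one index as in `IsLGS`), `μ̃ := μ_{(ℋ)}(𝕀)` with `(ℋ) = Ideal.span (range h)`. Stated for ANY family;
it is the printed invariant when `IsLGS p 𝕀 h e` for the 𝔇-saturated `𝕀`. Its independence of the leading generator
system (Rem. 3.2.2.2 (1): «We will see in Part II …», = KM 2010 Prop. 3.1.2.1) is NOT proved here.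
[cite: Kawanoue2007, Def. 3.2.2.1] -/
def muTilde (𝕀 : IdealisticFiltration R) {ι : Type*} (h : ι → R) : ℝ≥0∞ :=
  muMod (Ideal.span (Set.range h)) 𝕀.carrier

/-- `μ̃ ≤ ord_ℋ(f)/a` for every `(f, a) ∈ 𝕀` with `a > 0`. [cite: Kawanoue2007, Def. 3.2.2.1] -/
theorem muTilde_le (𝕀 : IdealisticFiltration R) {ι : Type*} (h : ι → R) {f : R} {a : ℝ}
    (hf : f ∈ 𝕀.level a) (ha : 0 < a) : muTilde 𝕀 h ≤ muModElem (Ideal.span (Set.range h)) f a :=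
  muMod_le_muModElem _ (show (f, a) ∈ 𝕀.carrier from hf) ha

/-- `c ≤ μ̃ ⟺ c ≤ ord_ℋ(f)/a` for all `(f, a) ∈ 𝕀`, `a > 0`. [cite: Kawanoue2007, Def. 3.2.2.1] -/
theorem le_muTilde_iff (𝕀 : IdealisticFiltration R) {ι : Type*} (h : ι → R) {c : ℝ≥0∞} :
    c ≤ muTilde 𝕀 h ↔ ∀ (f : R) (a : ℝ), f ∈ 𝕀.level a → 0 < a →
      c ≤ muModElem (Ideal.span (Set.range h)) f a :=
  le_muMod_iff _

/-- With an EMPTY leading generator system (`σ(e) = d` for all `e`), `μ̃` is the plain order infimum `μ_{(0)}(𝕀)`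
(`ordMod_bot`: `ord_∅ = ` the `𝔪`-adic order). [cite: Kawanoue2007, Def. 3.2.2.1] -/
theorem muTilde_of_isEmpty (𝕀 : IdealisticFiltration R) {ι : Type*} [IsEmpty ι] (h : ι → R) :
    muTilde 𝕀 h = muMod ⊥ 𝕀.carrier := by
  rw [muTilde, Set.range_eq_empty, Ideal.span_empty]

/-- `μ̃ = ∞` when every member `(f, a)`, `a > 0`, of `𝕀` has `f ∈ (ℋ)` (e.g. `𝕀` generated by the leading generators
themselves). [cite: Kawanoue2007, Def. 3.2.2.1] -/
theorem muTilde_eq_top_of_mem (𝕀 : IdealisticFiltration R) {ι : Type*} (h : ι → R)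
    (hall : ∀ (f : R) (a : ℝ), f ∈ 𝕀.level a → 0 < a → f ∈ Ideal.span (Set.range h)) :
    muTilde 𝕀 h = ⊤ := by
  refine eq_top_iff.mpr ((le_muTilde_iff 𝕀 h).mpr fun f a hf ha => ?_)
  rw [muModElem, ordMod_eq_top_of_mem (hall f a hf ha)]
  simp [ENNReal.top_div, ENNReal.ofReal_ne_top]

/-- `𝕀 ⊂ 𝕁 ⇒ μ̃(𝕁) ≤ μ̃(𝕀)` for the same family `ℋ`. [cite: Kawanoue2007, Def. 3.2.2.1] -/
theorem muTilde_anti (𝕀 𝕁 : IdealisticFiltration R) (hIJ : IdealisticFiltration.Incl 𝕀 𝕁) {ι : Type*}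
    (h : ι → R) : muTilde 𝕁 h ≤ muTilde 𝕀 h :=
  muMod_anti _ (IdealisticFiltration.incl_iff_carrier_subset.mp hIJ)

end MuTilde

end Literature.AlgebraicGeometry.Kawanoue2007

end
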